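import Summits.Ventures.HodgeRepro2.T6PeriodInput7
import Summits.Ventures.HodgeRepro2.T6PeriodInput6Toy2
import Summits.Ventures.HodgeRepro2.T6N5RichToyData
import Summits.Ventures.HodgeRepro2.T6PeriodInputToy2Tau
import Summits.Ventures.HodgeRepro2.T6N41PlaceUnivD41

/-!
# T6PeriodInput7Toy2 — THE JOINT TOY v2 ON THE M2 v7 OBJECT: `periodInputN_of_published₇` fires on `toy2 D σ₀` with
EVERY one of its 170 binders a theorem on the toy (the §10.5(ii)(d) witness of v7)

Cell pub-hodge-repro2, Tier 6 (README §10), seat t6-p6 (the (γ) assembly lineage; the t6-lead's word STATUS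
l. 11672 (c) / l. 11868 (3) / l. 11870 (3): file name and theorem name as ruled; the lead declares v7 superseding
v6 on its accept). Proof lane; count-neutral.

THE CARRIER is unchanged: `PeriodInput6Toy2.toy2 D σ₀ : NAut3 F (D.ndatum σ₀)` (T6PeriodInput6Toy2 p409931 — the
joint toy v2 on t6-p1's non-degenerate N1 instance `WitData F`: sides `N3ToyV.sideV (LGw K) f_A` / `f_B`
(t6-p3's `witN3`), `sA = sB = N43Toy.bergmanNSide`, `d5 = N5Toy.toyData`). THE THEOREM
`toy2_periodInputN_of_published₇ D σ₀` applies the lead's `periodInputN_of_published₇` (T6PeriodInput7 = v6 with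
t6-p4's placement / τ′ drop-in and t6-p7's N5Rich drop-in merged; 170 binders) with v6's 131 arguments as in
T6PeriodInput6Toy2 (the four N1 displays, N2's explicit shape, t6-p3's N3 packages, the Bergman bundles, N4.1–N4.3,
`hR`, `hT`, `hc5`) and, for the 39 new slots:
* the PLACEMENT CHAIN per side (14 slots) — t6-p4's `N41PlaceUniv.d41Pl / d41In / d41Sp / d41LQ / d41Kd` on
  `toyD41` (= `bergmanNSide.d41` by rfl) with `d41_LR7 d41_Bump d41_Harris d41_Rogawski d41_Minguez d41_Bump451
  d41_Rao d41_dich d41_kappa'` (T6N41PlaceUnivD41: the seven displays, the dichotomy and the residual `hκ'` as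
  theorems — Bump (5.22) / Mínguez / Bump 4.5.1 by construction, Harris / Rogawski / Rao by computation, LR §7 and
  the off-`S` clauses vacuous on `toyD41`, `S` = every place);
* the τ′ LAYER per side (5 slots) — `TdA / TdB := PeriodInputToy2Tau.tdB (LGw K) f_A / f_B`, the pure-tensor test
  datum on the joint sides over `bergmanNSide` (T6PeriodInputToy2Tau), with GQT Thm 11.4(ii)+(11.3) a theorem
  because `f_A ≠ 0` / `f_B ≠ 0` (t6-p3's `fA_ne_zero` / `fB_ne_zero`), GQT §11.6 on the unramified datum
  `(1, 1, 1)`, and t6-p5's GQT Prop. 11.6(i) instances `prop35_split` / `prop35_nonsplit` on `toyFinitePlaces`;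
* the N5 RICH block (8 slots) — t6-p7's `N5RichToyData.toyRich` with the re-point equation
  `toyRich_toN5Data : toyRich.toN5Data = toyData` (so `hR5 := toyRich_toN5Data.symm` on `d5 = toyData`),
  `hL / hsol / hre` from `toyRich_joint`, and the (S–H) dictionary `dict := 1` on the toy's trivial letters
  `rA = rB = 1` (`hA / hB := (MonoidHom.one_apply _).symm`).
NO hypothesis anywhere: every statement of this file is a theorem of `D : WitData F` and `σ₀ : K →+* ℂ`. The
conclusion is NOT vacuous: `toy2_conclusion_holds` (T6PeriodInput6Toy2) gives `Hyp.PeriodN` at every choice.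
§8(d): uses an L-value-free non-vanishing device: NO.
-/

namespace Summit.Ventures.HodgeRepro2.T6.PeriodInput7Toy2

open scoped InnerProductSpace
open N1Wit N1Wit.WitData N3WitInstance N3ToyV N3Toy N2ToyIso N2ToyIsoS N42Toy N42ToyNSide N43Toy N5Toy
open PeriodInput6Toy2 PeriodInputToy2Tau N41PlaceUniv N5RichToyData

variable {K : Type} [Field K] [NumberField K] [NumberField.IsCMField K] {F : FaceSetting K}
variable (D : WitData F) (σ₀ : K →+* ℂ)

/-! ## 1. The τ′ test data on the joint toy's sides -/

/-- The τ′ test datum on side A (`sideV (LGw K) f_A` over `bergmanNSide`). -/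
noncomputable def TdA : TauDatum (toy2 D σ₀).d3.A (toy2 D σ₀).sA := tdB (WitData.LGw K) (fA D σ₀)

/-- The τ′ test datum on side B (`sideV (LGw K) f_B` over `bergmanNSide`). -/
noncomputable def TdB : TauDatum (toy2 D σ₀).d3.B (toy2 D σ₀).sB := tdB (WitData.LGw K) (fB D σ₀)

/-- GQT Thm 11.4(ii) + (11.3) on side A's test datum (`f_A ≠ 0`). -/
theorem TdA_rallis : Hyp.GQT2014_Thm11_4_ii_Rallis (TdA D σ₀) := tdB_rallis (fA_ne_zero D σ₀)

/-- GQT Thm 11.4(ii) + (11.3) on side B's test datum (`f_B ≠ 0`). -/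
theorem TdB_rallis : Hyp.GQT2014_Thm11_4_ii_Rallis (TdB D σ₀) := tdB_rallis (fB_ne_zero D σ₀)

/-- GQT §11.6's unramified identity on side A's test datum. -/
theorem TdA_unramified : Hyp.GQT2014_Sec11_6_Unramified (TdA D σ₀) := tdB_unramified _

/-- GQT §11.6's unramified identity on side B's test datum. -/
theorem TdB_unramified : Hyp.GQT2014_Sec11_6_Unramified (TdB D σ₀) := tdB_unramified _

/-! ## 2. The M2 v7 theorem on the joint toy v2 -/

/-- THE M2 v7 OBJECT FIRES ON THE JOINT TOY v2 WITH EVERY BINDER A THEOREM ON THE TOY: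
`periodInputN_of_published₇` applied to `toy2 D σ₀`, NO hypothesis. The conclusion is
`∃ c, AdmChoice c ∧ Hyp.PeriodN (shadow c)` on t6-p1's datum, where the period is non-zero at every choice
(`PeriodInput6Toy2.toy2_conclusion_holds`). -/
theorem toy2_periodInputN_of_published₇ :
    ∃ c, (D.ndatum σ₀).AdmChoice c ∧ Hyp.PeriodN ((D.ndatum σ₀).shadow c) := by
  obtain ⟨hR0, hR1, hR2, hs, hRbr, hO, hsimp, hPX, hPeqX, hPY, hPeqY, hσX, hσ⟩ :=
    witN3_N3iso_binders D σ₀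
  exact periodInputN_of_published₇ (toy2 D σ₀) (toy2_hex D σ₀)
    (isCMFrame_frameOf F.deg6) (isLiuSignElement_e111Of (isCMFrame_frameOf F.deg6))
    (magSpec_uOf (isCMFrame_frameOf F.deg6)) rfl
    (witN2_admGenerating D σ₀) toyR hR0 hR1 hR2 hs (toyVW_AutStable _ _) hRbr hO hsimp hPX hPeqX
    hPY hPeqY hσX hσ
    (D.displays σ₀).1 (D.displays σ₀).2.1 (D.displays σ₀).2.2.1 (D.displays σ₀).2.2.2
    (fun _ : Unit => toyS) (fun _ => toyS_ganTakeda) (toyVW_HoweDualityBridge_A (fA D σ₀) (fB D σ₀))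
    (toyV_KliftCont (fA D σ₀)) (toyV_Seam (fA D σ₀)) (toyV_Adjoint (fA D σ₀))
    (toyV_KliftLevel (fA D σ₀)) (toyV_ThetaTauType (fA D σ₀)) (toyV_CopiesEquivariant (fA D σ₀))
    (toyV_CopiesOrthogonal (fA D σ₀)) (toyV_CopiesIncl (fA D σ₀)) (toyV_CopiesTauType (fA D σ₀))
    (toyV_TauTypeDecomposes (fA D σ₀)) (toyV_LevelPartFinite (fA D σ₀))
    (toyV_LevelPartCont (fA D σ₀)) (toyV_KAverage (fA D σ₀)) (toyV_ThetaEquivariant (fA D σ₀))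
    (toyV_SpanOfFixedVector (fA D σ₀)) (toyV_CrossCopyOrthogonal (fA D σ₀))
    (toyV_CopyIndependence (fA D σ₀)) (toyV_TensorsSpan (fA D σ₀))
    (fun _ : Unit => toyS) (fun _ => toyS_ganTakeda) (toyVW_HoweDualityBridge_B (fA D σ₀) (fB D σ₀))
    (toyV_KliftCont (fB D σ₀)) (toyV_Seam (fB D σ₀)) (toyV_Adjoint (fB D σ₀))
    (toyV_KliftLevel (fB D σ₀)) (toyV_ThetaTauType (fB D σ₀)) (toyV_CopiesEquivariant (fB D σ₀))
    (toyV_CopiesOrthogonal (fB D σ₀)) (toyV_CopiesIncl (fB D σ₀)) (toyV_CopiesTauType (fB D σ₀))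
    (toyV_TauTypeDecomposes (fB D σ₀)) (toyV_LevelPartFinite (fB D σ₀))
    (toyV_LevelPartCont (fB D σ₀)) (toyV_KAverage (fB D σ₀)) (toyV_ThetaEquivariant (fB D σ₀))
    (toyV_SpanOfFixedVector (fB D σ₀)) (toyV_CrossCopyOrthogonal (fB D σ₀))
    (toyV_CopyIndependence (fB D σ₀)) (toyV_TensorsSpan (fB D σ₀))
    bergmanToy bergmanToy rfl rfl
    -- side A: N4.2, N4.3, the bridges, N4.1 (as v6, minus `hunr`)
    ⟨fun _ => ⟨toyPair_irreducible, toyPair_smooth⟩, fun _ => ⟨trivial_irreducible, trivial_smooth⟩⟩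
    (fun _ => Nat.zero_lt_succ 1) (fun _ => Nat.le_succ 2) (fun _ => toyTower_firstLift)
    (fun _ => toyTypeII_minguez) (fun _ => toyTower_ganIchino)
    bergmanNSide_EL₁ bergmanNSide_A2f₂ bergmanNSide_EL₂ bergmanNSide_A2f₃ bergmanNSide_EL₃
    (bergmanNSide_conj11_5 _ 0) (bergmanNSide_conj11_5 _ 1) (bergmanNSide_conj11_5 _ 2)
    toyD41_GQT toyD41_LR toyD41_padic toyD41_eulerE₁ toyD41_eulerE₂ toyD41_thm31₁ toyD41_thm31₂
    toyD41_prop44₁ toyD41_prop44₂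
    -- side A: the placement chain on `toyD41` (t6-p4's T6N41PlaceUnivD41), `hR`, the τ′ layer (t6-p6's seam)
    d41Pl d41In d41Sp d41LQ d41Kd d41_LR7 d41_Bump d41_Harris d41_Rogawski d41_Minguez d41_Bump451 d41_Rao
    d41_dich d41_kappa' (toy2_thm11_7_A D σ₀)
    (TdA D σ₀) (TdA_rallis D σ₀) (TdA_unramified D σ₀) prop35_split prop35_nonsplit
    -- side B: the same
    ⟨fun _ => ⟨toyPair_irreducible, toyPair_smooth⟩, fun _ => ⟨trivial_irreducible, trivial_smooth⟩⟩
    (fun _ => Nat.zero_lt_succ 1) (fun _ => Nat.le_succ 2) (fun _ => toyTower_firstLift)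
    (fun _ => toyTypeII_minguez) (fun _ => toyTower_ganIchino)
    bergmanNSide_EL₁ bergmanNSide_A2f₂ bergmanNSide_EL₂ bergmanNSide_A2f₃ bergmanNSide_EL₃
    (bergmanNSide_conj11_5 _ 0) (bergmanNSide_conj11_5 _ 1) (bergmanNSide_conj11_5 _ 2)
    toyD41_GQT toyD41_LR toyD41_padic toyD41_eulerE₁ toyD41_eulerE₂ toyD41_thm31₁ toyD41_thm31₂
    toyD41_prop44₁ toyD41_prop44₂
    d41Pl d41In d41Sp d41LQ d41Kd d41_LR7 d41_Bump d41_Harris d41_Rogawski d41_Minguez d41_Bump451 d41_Rao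
    d41_dich d41_kappa' (toy2_thm11_7_B D σ₀)
    (TdB D σ₀) (TdB_rallis D σ₀) (TdB_unramified D σ₀) prop35_split prop35_nonsplit
    -- N5 (t6-p7's RICH toy): Theorem 5.6, the rich datum + the re-point equation, the construction facts,
    -- the trivial dictionary on the toy's trivial letters, the local solutions, (b) at the real places, (c)
    toyData_thm5_6 toyRich toyRich_toN5Data.symm toyRich_joint.2.2.1 1
    (MonoidHom.one_apply _).symm (MonoidHom.one_apply _).symm toyRich_joint.2.2.2.2.1
    toyRich_joint.2.2.2.2.2.1 ⟨toySide_condC, toySide_condC⟩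

end Summit.Ventures.HodgeRepro2.T6.PeriodInput7Toy2
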